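import Mathlib
import HarnessLib
import Summits.HubbardSuperconductivity.HubbardSuperconductivity.Theorems.KLProgrammeC4aTubeTadpoleValue
import Summits.HubbardSuperconductivity.HubbardSuperconductivity.Theorems.KLProgrammeC4aLevelDensityRadial

/-!
# Route `KLProgramme` — crux C4a, value layer (k = 0): the Hartree value of the tube tadpole with the RADIAL ROW discharged, and the
# (L3-val) dominator of `…C4aTubeTadpoleValue` modulo the vertex's own odd-difference

Cell `gate-hubbard-kl`, lane hubbard-kl-k3c3-p3 (g10, Jacobian-certificate lineage); helper for the engine-flow child `KLRegimeEngineV17F2`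
(stmt-HubbardSuperconductivity-20437), stub (C) `stub_twoLeg_curvature`, k = 0 VALUE clause (located risk #12 «(C)-VALUE-K0»).  Companion of
`…C4aLevelDensityRadial` (the row `|N_K(ρ) − N_K(−ρ)| ≤ 4π·jacR·|ρ|`, `jacR = 1/(Dt_min − 2A)² + π√2·(2 + 4A)/(Dt_min − 2A)³`), written in the
spelling of c4a-1's `…C4aTubeTadpoleValue`:
* **`norm_tubeTadpole_const_le_radial`** — `norm_tubeTadpole_const_le` with its `hJ`/`hfd` inputs discharged: for an odd level profile `f` supported in
  `(−r, r)` and the constant vertex `c`, `‖T(θ)‖ ≤ 2π·jacR·‖c‖·∫_{(−r,r)} ‖f(ρ)‖·|ρ| dρ` (first radial moment of the slice `≍ Λ_n²`: the `C₀|U|Λ_n²`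
  value law of the k = 0 slot, constant uniform in the frame and the window);
* **`norm_tubeAngularAvg_sub_le`** — the dominator `hd` of `norm_tubeTadpole_pair_le` / `norm_tubeTadpole_le_of_odd`:
  `‖tubeAngularAvg μ K Vp θ ρ − tubeAngularAvg μ K Vm θ (−ρ)‖ ≤ 4π·jacR·|ρ|·M + (π√2/(Dt_min − 2A))·∫_{(0,2π]} e_ρ` whenever `‖Vp‖ ≤ M` on the level
  circle and the VERTEX odd-difference along the chart is dominated by `e_ρ` — (L3-val) reduced to the vertex's own radial odd-difference;
* numeric envelopes `jacRadialConst_le_of_Dtmin_tableA/B`: `jacR ≤ 34` on `klWindowC ± 3/80` (`Dt_min ≥ 0.6585`), `≤ 41` on `[−1.1, −0.1]`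
  (`Dt_min ≥ 0.6225`), for frames of `C²` size `A ≤ 10⁻³` — the row's NUMBER next to the angular `G_i` of `FreeBandPolarJets`.
Pure calculus on the tree's objects; nothing is asserted about the Hubbard model.  References: BGM 2006 §2.4 [cite: BenfattoGiulianiMastropietro2006].
-/

noncomputable section

namespace Summit.HubbardSuperconductivity.HubbardSuperconductivity.Theorems.C4a

set_option linter.dupNamespace false -- summit = problem name (single-conjunct summit), D-0017

open Real Set MeasureTheory Filter
open scoped ContDiff Topology
open Literature.MathematicalPhysics.QuantumLattice Literature.MathematicalPhysics.QuantumLattice.BandSectorCounting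
open Summit.HubbardSuperconductivity.HubbardSuperconductivity.Theorems.DispersionFlow
open Summit.HubbardSuperconductivity.HubbardSuperconductivity.Theorems.KLRegimeSplit
open Summit.HubbardSuperconductivity.HubbardSuperconductivity.Theorems.PerturbedFermiCurve

section Value

variable {a b : ℝ} (B : BandBounds a b) {K : TrigPolyC4v} {A : ℝ}
  (hA : ∀ p : Momentum, ∀ j ≤ 2, ‖iteratedFDeriv ℝ j (frameShift K) p‖ ≤ A) (hADt : 2 * A < B.Dtmin)
  {μ r : ℝ} (hlo : a < μ - r - A) (hhi : μ + r + A < b)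
include B hA hADt hlo hhi

omit B hA hADt hlo hhi in
/-- Integrability of `‖f‖·(C·|ρ|)` on the level range for a continuous profile (the side condition `hfd` of `norm_tubeTadpole_const_le`). -/
theorem integrableOn_norm_mul_const_mul_abs {f : ℝ → ℂ} (hf : Continuous f) (C : ℝ) :
    IntegrableOn (fun ρ : ℝ => ‖f ρ‖ * (C * |ρ|)) (Ioo (-r) r) :=
  (((continuous_norm.comp hf).mul (continuous_const.mul continuous_abs)).continuousOn.integrableOn_compact
      isCompact_Icc).mono_set Ioo_subset_Icc_self

/-- **THE HARTREE VALUE, radial row discharged.**  For an odd level profile `f` supported in `(−r, r)` and the constant vertex `c` (the bare `U`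
times frequency phases), the momentum-space tube tadpole read at any curve point satisfies
`‖T(θ)‖ ≤ 2π·(1/(Dt_min − 2A)² + π√2·(2 + 4A)/(Dt_min − 2A)³)·‖c‖·∫_{(−r,r)} ‖f(ρ)‖·|ρ| dρ`
— the first radial moment of the slice (`≍ Λ_n²`: the `C₀|U|Λ_n²` value law of the k = 0 slot), with a constant depending on the window only through
`Dt_min` and on the frame only through its `C²` size `A`. -/
theorem norm_tubeTadpole_const_le_radial {f : ℝ → ℂ} (hf : ContDiff ℝ ∞ f) (hfsupp : tsupport f ⊆ Ioo (-r) r)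
    (hodd : ∀ ρ, f (-ρ) = -f ρ) (c : ℂ) (θ : ℝ) :
    ‖∫ q in {q : ℝ × ℝ | |q.1| < π ∧ |q.2| < π ∧ |frameLevel μ K (WithLp.toLp 2 ![q.1, q.2])| < r},
        f (frameLevel μ K (WithLp.toLp 2 ![q.1, q.2])) * (fun _ _ : Momentum => c) (levelPoint μ K 0 θ) (WithLp.toLp 2 ![q.1, q.2])‖ ≤
      2 * π * (1 / (B.Dtmin - 2 * A) ^ 2 + Real.pi * Real.sqrt 2 * (2 + 4 * A) / (B.Dtmin - 2 * A) ^ 3) *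
        (‖c‖ * ∫ ρ in Ioo (-r) r, ‖f ρ‖ * |ρ|) := by
  set C := 1 / (B.Dtmin - 2 * A) ^ 2 + Real.pi * Real.sqrt 2 * (2 + 4 * A) / (B.Dtmin - 2 * A) ^ 3 with hCdef
  have h := norm_tubeTadpole_const_le B hA hADt hlo hhi hf hfsupp hodd c θ (dJ := fun ρ => 4 * π * C * |ρ|)
    (abs_levelDensity_sub_neg_le B hA hADt hlo hhi) (integrableOn_norm_mul_const_mul_abs hf.continuous (4 * π * C))
  refine h.trans (le_of_eq ?_)
  have hI : (∫ ρ in Ioo (-r) r, ‖f ρ‖ * (4 * π * C * |ρ|)) = 4 * π * C * ∫ ρ in Ioo (-r) r, ‖f ρ‖ * |ρ| := by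
    rw [← integral_const_mul]
    exact integral_congr_ae (Filter.Eventually.of_forall fun ρ => by simp only; ring)
  rw [hI]
  ring

/-- **The (L3-val) dominator modulo the vertex's own odd-difference** (`tubeAngularAvg` spelling of
`…C4aLevelDensityRadial.norm_setIntegral_jac_smul_sub_le`): the hypothesis `hd` of `norm_tubeTadpole_pair_le` / `norm_tubeTadpole_le_of_odd` holds with
`d ρ = 4π·jacR·|ρ|·M + (π√2/(Dt_min − 2A))·∫_{(0,2π]} e_ρ` as soon as the vertex is bounded by `M` on the level circle and its radial odd-difference along
the chart is dominated by `e_ρ` — the Jacobian's share of (L3-val) discharged. -/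
theorem norm_tubeAngularAvg_sub_le {Vp Vm : Momentum → Momentum → ℂ}
    (hVp : ContDiff ℝ ∞ fun x : Momentum × Momentum => Vp x.1 x.2) (hVm : ContDiff ℝ ∞ fun x : Momentum × Momentum => Vm x.1 x.2)
    (θ : ℝ) {ρ : ℝ} (hρ : ρ ∈ Ioo (-r) r) {M : ℝ}
    (hM : ∀ ϑ ∈ Ioc 0 (2 * π), ‖Vp (levelPoint μ K 0 θ) (levelPoint μ K ρ ϑ)‖ ≤ M) {e : ℝ → ℝ}
    (he : ∀ ϑ ∈ Ioc 0 (2 * π),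
      ‖Vp (levelPoint μ K 0 θ) (levelPoint μ K ρ ϑ) - Vm (levelPoint μ K 0 θ) (levelPoint μ K (-ρ) ϑ)‖ ≤ e ϑ)
    (heI : IntegrableOn e (Ioc 0 (2 * π))) :
    ‖tubeAngularAvg μ K Vp θ ρ - tubeAngularAvg μ K Vm θ (-ρ)‖ ≤
      4 * π * (1 / (B.Dtmin - 2 * A) ^ 2 + Real.pi * Real.sqrt 2 * (2 + 4 * A) / (B.Dtmin - 2 * A) ^ 3) * |ρ| * M +
        Real.pi * Real.sqrt 2 / (B.Dtmin - 2 * A) * ∫ ϑ in Ioc 0 (2 * π), e ϑ := by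
  rw [tubeAngularAvg_apply, tubeAngularAvg_apply]
  exact norm_setIntegral_jac_smul_sub_le B hA hADt hlo hhi hVp hVm θ hρ hM he heI

/-- **Single-vertex form** (`Vp = Vm = V`, the hypothesis `hd` of `norm_tubeTadpole_le_of_odd`). -/
theorem norm_tubeAngularAvg_sub_neg_le {V : Momentum → Momentum → ℂ} (hV : ContDiff ℝ ∞ fun x : Momentum × Momentum => V x.1 x.2)
    (θ : ℝ) {ρ : ℝ} (hρ : ρ ∈ Ioo (-r) r) {M : ℝ}
    (hM : ∀ ϑ ∈ Ioc 0 (2 * π), ‖V (levelPoint μ K 0 θ) (levelPoint μ K ρ ϑ)‖ ≤ M) {e : ℝ → ℝ}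
    (he : ∀ ϑ ∈ Ioc 0 (2 * π),
      ‖V (levelPoint μ K 0 θ) (levelPoint μ K ρ ϑ) - V (levelPoint μ K 0 θ) (levelPoint μ K (-ρ) ϑ)‖ ≤ e ϑ)
    (heI : IntegrableOn e (Ioc 0 (2 * π))) :
    ‖tubeAngularAvg μ K V θ ρ - tubeAngularAvg μ K V θ (-ρ)‖ ≤
      4 * π * (1 / (B.Dtmin - 2 * A) ^ 2 + Real.pi * Real.sqrt 2 * (2 + 4 * A) / (B.Dtmin - 2 * A) ^ 3) * |ρ| * M +
        Real.pi * Real.sqrt 2 / (B.Dtmin - 2 * A) * ∫ ϑ in Ioc 0 (2 * π), e ϑ :=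
  norm_tubeAngularAvg_sub_le B hA hADt hlo hhi hV hV θ hρ hM he heI

/-! ## Numeric envelopes of the radial-row constant on the certified windows (next to the angular `G_i` of `FreeBandPolarJets`) -/

omit hA hADt hlo hhi in
/-- **Table A window** (`klWindowC ± 3/80`, certified `Dt_min ≥ 0.6585`, `…PerturbedFermiCurveWindowJetsDefs.klwjTableA`): for frames of `C²` size
`A ≤ 10⁻³`, `jacR = 1/(Dt_min − 2A)² + π√2·(2 + 4A)/(Dt_min − 2A)³ ≤ 34` (so `dJ(ρ) ≤ 428·|ρ|` and the Hartree value is `≤ 214·‖c‖·∫‖f‖|ρ|`). -/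
theorem jacRadialConst_le_of_Dtmin_tableA (hDt : 0.6585 ≤ B.Dtmin) (hA0 : 0 ≤ A) (hA1 : A ≤ 1 / 1000) :
    1 / (B.Dtmin - 2 * A) ^ 2 + Real.pi * Real.sqrt 2 * (2 + 4 * A) / (B.Dtmin - 2 * A) ^ 3 ≤ 34 := by
  have hd : 0.6565 ≤ B.Dtmin - 2 * A := by linarith
  have hπ : Real.pi < 3.15 := Real.pi_lt_d2
  have hs : Real.sqrt 2 < 1.415 := by
    rw [show (1.415 : ℝ) = Real.sqrt (1.415 ^ 2) by rw [Real.sqrt_sq (by norm_num)]]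
    exact Real.sqrt_lt_sqrt (by norm_num) (by norm_num)
  have hπs : Real.pi * Real.sqrt 2 ≤ 4.458 := by nlinarith [Real.pi_pos, Real.sqrt_nonneg 2]
  have h1 : 1 / (B.Dtmin - 2 * A) ^ 2 ≤ 1 / (0.6565 : ℝ) ^ 2 :=
    one_div_le_one_div_of_le (by norm_num) (pow_le_pow_left₀ (by norm_num) hd 2)
  have h3 : 1 / (B.Dtmin - 2 * A) ^ 3 ≤ 1 / (0.6565 : ℝ) ^ 3 :=
    one_div_le_one_div_of_le (by norm_num) (pow_le_pow_left₀ (by norm_num) hd 3)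
  have h2 : Real.pi * Real.sqrt 2 * (2 + 4 * A) ≤ 4.458 * 2.004 :=
    mul_le_mul hπs (by linarith) (by linarith) (by norm_num)
  have hnum : 1 / (0.6565 : ℝ) ^ 2 + 4.458 * 2.004 * (1 / (0.6565 : ℝ) ^ 3) ≤ 34 := by norm_num
  calc 1 / (B.Dtmin - 2 * A) ^ 2 + Real.pi * Real.sqrt 2 * (2 + 4 * A) / (B.Dtmin - 2 * A) ^ 3
      = 1 / (B.Dtmin - 2 * A) ^ 2 + Real.pi * Real.sqrt 2 * (2 + 4 * A) * (1 / (B.Dtmin - 2 * A) ^ 3) := by ring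
    _ ≤ 1 / (0.6565 : ℝ) ^ 2 + 4.458 * 2.004 * (1 / (0.6565 : ℝ) ^ 3) := by
        have h0 : 0 ≤ Real.pi * Real.sqrt 2 * (2 + 4 * A) := by positivity
        exact add_le_add h1 (mul_le_mul h2 h3 (by positivity) (by norm_num))
    _ ≤ 34 := hnum

omit hA hADt hlo hhi in
/-- **Table B window** (`[−1.1, −0.1]`, certified `Dt_min ≥ 0.6225`, `klwjTableB`): for `A ≤ 10⁻³`, `jacR ≤ 41`. -/
theorem jacRadialConst_le_of_Dtmin_tableB (hDt : 0.6225 ≤ B.Dtmin) (hA0 : 0 ≤ A) (hA1 : A ≤ 1 / 1000) :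
    1 / (B.Dtmin - 2 * A) ^ 2 + Real.pi * Real.sqrt 2 * (2 + 4 * A) / (B.Dtmin - 2 * A) ^ 3 ≤ 41 := by
  have hd : 0.6205 ≤ B.Dtmin - 2 * A := by linarith
  have hπ : Real.pi < 3.15 := Real.pi_lt_d2
  have hs : Real.sqrt 2 < 1.415 := by
    rw [show (1.415 : ℝ) = Real.sqrt (1.415 ^ 2) by rw [Real.sqrt_sq (by norm_num)]]
    exact Real.sqrt_lt_sqrt (by norm_num) (by norm_num)
  have hπs : Real.pi * Real.sqrt 2 ≤ 4.458 := by nlinarith [Real.pi_pos, Real.sqrt_nonneg 2]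
  have h1 : 1 / (B.Dtmin - 2 * A) ^ 2 ≤ 1 / (0.6205 : ℝ) ^ 2 :=
    one_div_le_one_div_of_le (by norm_num) (pow_le_pow_left₀ (by norm_num) hd 2)
  have h3 : 1 / (B.Dtmin - 2 * A) ^ 3 ≤ 1 / (0.6205 : ℝ) ^ 3 :=
    one_div_le_one_div_of_le (by norm_num) (pow_le_pow_left₀ (by norm_num) hd 3)
  have h2 : Real.pi * Real.sqrt 2 * (2 + 4 * A) ≤ 4.458 * 2.004 :=
    mul_le_mul hπs (by linarith) (by linarith) (by norm_num)
  have hnum : 1 / (0.6205 : ℝ) ^ 2 + 4.458 * 2.004 * (1 / (0.6205 : ℝ) ^ 3) ≤ 41 := by norm_num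
  calc 1 / (B.Dtmin - 2 * A) ^ 2 + Real.pi * Real.sqrt 2 * (2 + 4 * A) / (B.Dtmin - 2 * A) ^ 3
      = 1 / (B.Dtmin - 2 * A) ^ 2 + Real.pi * Real.sqrt 2 * (2 + 4 * A) * (1 / (B.Dtmin - 2 * A) ^ 3) := by ring
    _ ≤ 1 / (0.6205 : ℝ) ^ 2 + 4.458 * 2.004 * (1 / (0.6205 : ℝ) ^ 3) := by
        have h0 : 0 ≤ Real.pi * Real.sqrt 2 * (2 + 4 * A) := by positivity
        exact add_le_add h1 (mul_le_mul h2 h3 (by positivity) (by norm_num))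
    _ ≤ 41 := hnum

end Value

end Summit.HubbardSuperconductivity.HubbardSuperconductivity.Theorems.C4a

end
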